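import Mathlib
import Summits.Ventures.HodgeRepro.Tier4.Target
import Summits.Ventures.HodgeRepro.Tier4.Common.TargetBall
import Summits.Ventures.HodgeRepro.Tier4.Common.TargetCalculus
import Summits.Ventures.HodgeRepro.Tier4.Common.TargetJacobian
import Summits.Ventures.HodgeRepro.Tier4.Common.AutForms
import Summits.Ventures.HodgeRepro.Tier4.Line3.KMDatumS
import Summits.Ventures.HodgeRepro.Tier4.Line3.Defs
import Summits.Ventures.HodgeRepro.Tier4.Line3.HeckeEquivarianceLemmas
import Summits.Ventures.HodgeRepro.Tier4.Line3.LocaliserS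
import Summits.Ventures.HodgeRepro.Tier4.Line3.BallChangeOfVariables
import Summits.Ventures.HodgeRepro.Tier4.Line3.DomainTransfer
import Summits.Ventures.HodgeRepro.Tier4.Line3.KernelEquivariance
import Summits.Ventures.HodgeRepro.Tier4.Line3.CoefInvariance
import Summits.Ventures.HodgeRepro.Tier4.Line3.TorusInvariance
import Summits.Ventures.HodgeRepro.Tier4.Line3.MajorantLemmas
import Summits.Ventures.HodgeRepro.Tier4.Line3.IntegrableMajorant
import Summits.Ventures.HodgeRepro.Tier4.Line3.ExpansionPointwise
import Summits.Ventures.HodgeRepro.Tier4.Line3.Expansion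
import Summits.Ventures.HodgeRepro.Tier4.Line3.InvariantDensityTransfer

/-!
# Tier4/Line3/OffMainInvariance — the off-main density of a level is an invariant density (transfer R6, part 3)

Blind re-derivation cell `pub-hodge-repro`, Tier 4 «PROVE THE STEP» (README §9–§10), LINE L3, seat t4-L2-p1 (on L3.5
with t4-L2-p3, lead S12654); support module for the residual `OffMainMass` of L3.5 (`TermDominatedAssembly`).

For a level `K`, a combination `γ` of Hecke quadruples of level `K` and the main tuple `xm`, the OFF-MAIN DENSITY
`ρ(z) = Σ'_{w : orbitOf w ≠ orbitOf (lines xm)} ‖summand D.Φ D.cf γ w z‖ₑ` is `K`-INVARIANT as a `|det Jac|²`-density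
(`IsInvariantDensity X.τ₀ X.C K.1 ρ`): for `g ∈ K`, `w ↦ (lineEquiv g) ∘ w` is a bijection of the line tuples
preserving the orbits (`orbitStepL` by `g`), the quadruple coefficient is `K`-invariant (t4-L3-p1's
`coefQ_mulVec_mem_of_thetaData`) and the kernel transforms with the Jacobian (`kernel_equiv`), so the summands
match term by term (`summand_eq_of_lines_eq`).  With `lintegral_fundamentalDomain_eq_ae` (InvariantDensityTransfer)
the off-main mass over the tree's chosen domain of the level equals the off-main mass over ANY fundamental domain of
the level (`lintegral_offMainDensity_domain_eq`) — the choice-independence that the residual `OffMainMass` needs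
(t4-L2-p3's caveat S12794).  No printed input enters.
Nothing here says anything about the status of the Hodge conjecture for CM abelian varieties, which is NOT proved
(HC_CM is NOT proved by anyone in this repository).
-/

set_option autoImplicit false

noncomputable section

namespace Summit.Ventures.HodgeRepro.Tier4.Line3

open Summit.Ventures.HodgeRepro.Tier4
open Matrix MeasureTheory
open scoped ComplexConjugate ENNReal

open HeckeEquivariance

namespace T4Data

variable (X : T4Data)

/-- The off-main density of the combination `γ` (all orbits except that of `xm`). -/
def offMainDensity (D : X.ThetaData) {K : X.Level} (γ : X.Tr K) (xm : X.Tuple) (z : Fin 2 → ℂ) : ℝ≥0∞ :=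
  ∑' w : {w : X.LineTuple // X.orbitOf w ≠ X.orbitOf (X.lines xm)}, ‖X.summand D.Φ D.cf γ w.1 z‖ₑ

/-- The bijection of the line tuples induced by a unit matrix `g`, coordinatewise `lineEquiv g`. -/
def tupleEquivOf (g : Matrix (Fin 3) (Fin 3) X.E) (hg : IsUnit g.det) : X.LineTuple ≃ X.LineTuple :=
  Equiv.piCongrRight fun _ => lineEquiv X g hg

/-- `tupleEquivOf g w` is the line tuple of `g *ᵥ rep w`. -/
theorem lines_mulVec_rep (g : Matrix (Fin 3) (Fin 3) X.E) (hg : IsUnit g.det) (w : X.LineTuple) :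
    X.lines (fun j => g *ᵥ X.rep w j) = tupleEquivOf X g hg w := by
  funext j
  show Quot.mk X.lineStep (g *ᵥ Quot.out (w j)) = lineEquiv X g hg (w j)
  rw [lineEquiv_apply]

/-- The bijection preserves the orbits (it is one step of `orbitStepL`). -/
theorem orbitOf_tupleEquivOf {g : Matrix (Fin 3) (Fin 3) X.E} (hgu : IsUnitaryOf X.c X.H g) (hg : IsUnit g.det)
    (w : X.LineTuple) : X.orbitOf (tupleEquivOf X g hg w) = X.orbitOf w := by
  unfold T4Data.orbitOf
  refine (Quot.sound ⟨g, hgu, fun j => ?_⟩).symm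
  show tupleEquivOf X g hg w j = Quot.mk X.lineStep (g *ᵥ Quot.out (w j))
  exact lineEquiv_apply X g hg (w j)

/-- **The summand transforms as a density** under `g ∈ K`: `|det Jac φ_g (z)|² · summand (g·w) (φ_g z) = summand w z`. -/
theorem summand_tupleEquivOf (D : X.ThetaData) {K : X.Level} (γ : X.Tr K) {g : Matrix (Fin 3) (Fin 3) X.E}
    (hgK : g ∈ K.1) (hg : IsUnit g.det) (w : X.LineTuple) {z : Fin 2 → ℂ} (hz : z ∈ ball) :
    (Complex.normSq (jacDetMap (actM (toBallMat X.τ₀ X.C g)) z) : ℂ) *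
        X.summand D.Φ D.cf γ (tupleEquivOf X g hg w) (actM (toBallMat X.τ₀ X.C g) z) =
      X.summand D.Φ D.cf γ w z := by
  have hgu : IsUnitaryOf X.c X.H g := isUnitaryOf_of_mem_level X K hgK
  have h1 := X.summand_eq_of_lines_eq D.Φ D.cf D.weight γ (X.lines_rep w) z
  have h2 := X.summand_eq_of_lines_eq D.Φ D.cf D.weight γ (lines_mulVec_rep X g hg w)
    (actM (toBallMat X.τ₀ X.C g) z)
  rw [h1, h2, X.coefQ_mulVec_mem_of_thetaData D γ hgK (X.rep w), X.kernel_equiv D hgu (X.rep w) hz]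
  ring

/-- The bijection restricted to the off-main line tuples. -/
def offMainEquivOf {xm : X.Tuple} {g : Matrix (Fin 3) (Fin 3) X.E} (hgu : IsUnitaryOf X.c X.H g)
    (hg : IsUnit g.det) :
    {w : X.LineTuple // X.orbitOf w ≠ X.orbitOf (X.lines xm)} ≃
      {w : X.LineTuple // X.orbitOf w ≠ X.orbitOf (X.lines xm)} :=
  (tupleEquivOf X g hg).subtypeEquiv fun w => by rw [orbitOf_tupleEquivOf X hgu hg]

/-- **THE OFF-MAIN DENSITY IS `K`-INVARIANT** as a `|det Jac|²`-density. -/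
theorem offMainDensity_isInvariant (D : X.ThetaData) (K : X.Level) (γ : X.Tr K) (xm : X.Tuple) :
    IsInvariantDensity X.τ₀ X.C K.1 (X.offMainDensity D γ xm) := by
  rintro φ ⟨g, hgK, rfl⟩ z hz
  have hgu : IsUnitaryOf X.c X.H g := isUnitaryOf_of_mem_level X K hgK
  have hg : IsUnit g.det := isUnit_det_of_isUnitaryOf X hgu
  unfold offMainDensity
  rw [← ENNReal.tsum_mul_left, ← (offMainEquivOf X (xm := xm) hgu hg).tsum_eq]
  refine tsum_congr fun w => ?_
  have h := summand_tupleEquivOf X D γ hgK hg w.1 hz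
  have hnorm : ENNReal.ofReal (Complex.normSq (jacDetMap (actM (toBallMat X.τ₀ X.C g)) z)) =
      ‖(Complex.normSq (jacDetMap (actM (toBallMat X.τ₀ X.C g)) z) : ℂ)‖ₑ := by
    rw [← ofReal_norm, Complex.norm_real, Real.norm_of_nonneg (Complex.normSq_nonneg _)]
  rw [hnorm, ← enorm_mul]
  show ‖_ * X.summand D.Φ D.cf γ (tupleEquivOf X g hg w.1) (actM (toBallMat X.τ₀ X.C g) z)‖ₑ = _
  rw [h]

/-- The off-main density is a.e.-measurable on the ball (a countable sum of continuous functions). -/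
theorem aemeasurable_offMainDensity (D : X.ThetaData) {K : X.Level} (γ : X.Tr K) (xm : X.Tuple) :
    AEMeasurable (X.offMainDensity D γ xm) (volume.restrict ball) := by
  unfold offMainDensity
  refine AEMeasurable.tsum fun w => ?_
  exact ((Expansion.continuousOn_summand X D γ w.1).aemeasurable isOpen_ball.measurableSet).enorm

/-- **CHOICE-INDEPENDENCE of the off-main mass**: over the tree's chosen domain of the level, or over any other
fundamental domain of the level, the off-main mass is the same (when the chosen domain is a fundamental domain). -/
theorem lintegral_offMainDensity_domain_eq (D : X.ThetaData) (K : X.Level) (γ : X.Tr K) (xm : X.Tuple)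
    (hdom : IsFundamentalDomainFor (ballActions X.τ₀ X.C K.1) (X.domain K)) {D' : Set (Fin 2 → ℂ)}
    (hD' : IsFundamentalDomainFor (ballActions X.τ₀ X.C K.1) D') :
    ∫⁻ z in X.domain K, X.offMainDensity D γ xm z = ∫⁻ z in D', X.offMainDensity D γ xm z :=
  lintegral_fundamentalDomain_eq_ae K.2.1 (fun x => complexConj_intertwines X.E X.τ₀ x) X.hC hdom hD'
    (X.aemeasurable_offMainDensity D γ xm) (X.offMainDensity_isInvariant D K γ xm)

end T4Data

end Summit.Ventures.HodgeRepro.Tier4.Line3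

end
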